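import Literature.AlgebraicGeometry.Motives.ProjectiveSpaceComplexPointsCohomology
import Literature.AlgebraicGeometry.Motives.UnramifiedCohomology
import Literature.AlgebraicTopology.SingularHomology.CohomologyHomotopyInvariance
import HarnessLib

/-!
# Every positive-degree class on `ℙⁿ_ℂ(ℂ)` dies off a hyperplane (coniveau `≥ 1` on projective space)

For every coefficient ring `R`, every `n` and every `k ≥ 1`, EVERY class
`w ∈ Hᵏ(ℙⁿ⁺¹_ℂ(ℂ); R)` restricts to zero on the complex points of the complement of the coordinate
hyperplane `V₊(xₙ₊₁)`: that complement is the standard affine chart `D₊(xₙ₊₁)(ℂ) ≅ ℂⁿ⁺¹`, which is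
contractible (Serre, GAGA §2 n°5; the tree's
`ComplexPoints.projectiveSpace_contractibleSpace_compl_coordHyperplane`), so its positive-degree
cohomology vanishes (Hatcher §3.1 p. 201). In the language of the coniveau filtration
(`Motives.coniveauFiltration`, Bloch–Ogus 1974 (3.8)): `Hᵏ(ℙⁿ⁺¹_ℂ(ℂ); R) = N¹ Hᵏ` for `k ≥ 1`.

* `ComplexPoints.projectiveSpace_exists_restrictToCompl_eq_zero` — the restriction of every
  positive-degree class to `D₊(xₙ₊₁)(ℂ)` is zero, in the `∃ Z closed ≠ univ` form
  consumed by the product-descent theorems of `HodgeTheory/CrossProductsGenericDivisibility`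
  (Künneth factor `ℙⁿ⁺¹`: every basis class of positive degree dies generically);
* `ComplexPoints.projectiveSpace_mem_coniveauFiltration_one` — `w ∈ N¹ Hᵏ(ℙⁿ⁺¹_ℂ(ℂ); R)`.

Everything is proved; no definitions, no named facts.

## References

* J.-P. Serre, *Géométrie algébrique et géométrie analytique*, Ann. Inst. Fourier 6 (1956), §2 n°5
  Lemme 1, Prop. 2. [SerreGAGA1956]
* A. Hatcher, *Algebraic Topology* (2002), §3.1 p. 201 (cohomology of contractible spaces).
  [HatcherAT2002]
* S. Bloch, A. Ogus, Ann. Sci. ÉNS 7 (1974), (3.8). [BlochOgus1974ENS]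
-/

noncomputable section

open CategoryTheory AlgebraicGeometry Topology Function
open Literature.AlgebraicTopology.SingularHomology Literature.NumberTheory.Transcendental
open scoped LinearAlgebra.Projectivization

namespace Literature.AlgebraicGeometry.Motives

variable (R : Type) [CommRing R] (n : ℕ)

/-- **Every class of positive degree on `ℙⁿ⁺¹_ℂ(ℂ)` dies on the complex points of a non-empty Zariski
open** — the complement of the coordinate hyperplane `V₊(xₙ₊₁)`, a proper closed subset (the point
`[0 : ⋯ : 0 : 1]` lies off it). [cite: SerreGAGA1956, §2 n°5 Lemme 1 and Prop. 2]
[cite: HatcherAT2002, §3.1 p. 201] -/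
theorem ComplexPoints.projectiveSpace_exists_restrictToCompl_eq_zero {k : ℕ} (hk : k ≠ 0)
    (w : singularCohomology R R (ComplexPoints (projectiveSpace (n + 1) ℂ)) k) :
    ∃ Z : Set (projectiveSpace (n + 1) ℂ).left, IsClosed Z ∧ Z ≠ Set.univ ∧
      restrictToCompl R (projectiveSpace (n + 1) ℂ) k Z w = 0 := by
  letI := MvPolynomial.gradedAlgebra (σ := Fin (n + 1 + 1)) (R := ℂ)
  -- (1) restriction to the affine chart `D₊(xₙ₊₁)(ℂ) ≅ ℂⁿ⁺¹` (contractible) is zero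
  have h0 : restrictToCompl R (projectiveSpace (n + 1) ℂ) k
      {x : (projectiveSpace (n + 1) ℂ).left |
        x ∉ Proj.basicOpen (MvPolynomial.homogeneousSubmodule (Fin (n + 1 + 1)) ℂ)
          (MvPolynomial.X (Fin.last (n + 1)))} w = 0 := by
    -- the open piece is the (contractible) complement of the hyperplane `V₊(xₙ₊₁)(ℂ)`
    let e : complexPointsCompl (projectiveSpace (n + 1) ℂ)
        {x : (projectiveSpace (n + 1) ℂ).left |
          x ∉ Proj.basicOpen (MvPolynomial.homogeneousSubmodule (Fin (n + 1 + 1)) ℂ)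
            (MvPolynomial.X (Fin.last (n + 1)))} ≃ₜ
        ↥({Q : ComplexPoints (projectiveSpace (n + 1) ℂ) |
            Q.pt ∉ Proj.basicOpen (MvPolynomial.homogeneousSubmodule (Fin (n + 1 + 1)) ℂ)
              (MvPolynomial.X (Fin.last (n + 1)))}ᶜ) :=
      (Homeomorph.refl _).subtype fun P ↦ Iff.rfl
    haveI := ComplexPoints.projectiveSpace_contractibleSpace_compl_coordHyperplane n
    haveI : ContractibleSpace (complexPointsCompl (projectiveSpace (n + 1) ℂ)
        {x : (projectiveSpace (n + 1) ℂ).left |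
          x ∉ Proj.basicOpen (MvPolynomial.homogeneousSubmodule (Fin (n + 1 + 1)) ℂ)
            (MvPolynomial.X (Fin.last (n + 1)))}) :=
      e.contractibleSpace
    haveI := ModuleCat.subsingleton_of_isZero
      ((singularCochainComplex.isZero_singularCohomology_of_subsingleton' (R := R) (M := R)
        (X := PUnit.{1}) hk).of_iso
        (singularCohomology.isoOfContractible R R (complexPointsCompl (projectiveSpace (n + 1) ℂ)
          {x : (projectiveSpace (n + 1) ℂ).left |
            x ∉ Proj.basicOpen (MvPolynomial.homogeneousSubmodule (Fin (n + 1 + 1)) ℂ)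
              (MvPolynomial.X (Fin.last (n + 1)))}) k).symm)
    exact Subsingleton.elim _ _
  -- (2) the chart is the complement of a proper closed subset
  have hUo : IsOpen {x : (projectiveSpace (n + 1) ℂ).left |
      x ∈ Proj.basicOpen (MvPolynomial.homogeneousSubmodule (Fin (n + 1 + 1)) ℂ)
        (MvPolynomial.X (Fin.last (n + 1)))} :=
    (Proj.basicOpen (MvPolynomial.homogeneousSubmodule (Fin (n + 1 + 1)) ℂ)
      (MvPolynomial.X (Fin.last (n + 1)))).2
  have hZc : IsClosed {x : (projectiveSpace (n + 1) ℂ).left |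
      x ∉ Proj.basicOpen (MvPolynomial.homogeneousSubmodule (Fin (n + 1 + 1)) ℂ)
        (MvPolynomial.X (Fin.last (n + 1)))} := by
    rw [← Set.compl_setOf]
    exact hUo.isClosed_compl
  refine ⟨_, hZc, fun hZ ↦ ?_, h0⟩
  -- the point `[0 : ⋯ : 0 : 1]` lies in `D₊(xₙ₊₁)`
  have hv : (Pi.single (Fin.last (n + 1)) (1 : ℂ) : Fin (n + 1 + 1) → ℂ) ≠ 0 := by
    intro h
    have := congrFun h (Fin.last (n + 1))
    simp at this
  have hmem : (projPoint (n + 1) (Projectivization.mk ℂ _ hv)).pt ∈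
      Proj.basicOpen (MvPolynomial.homogeneousSubmodule (Fin (n + 1 + 1)) ℂ)
        (MvPolynomial.X (Fin.last (n + 1))) := by
    rw [pt_projPoint_mk_mem_basicOpen_iff (n + 1) _ hv one_pos
      ((MvPolynomial.mem_homogeneousSubmodule 1 (MvPolynomial.X (Fin.last (n + 1)))).mpr
        (MvPolynomial.isHomogeneous_X ℂ _)), MvPolynomial.eval_X]
    simp
  have : (projPoint (n + 1) (Projectivization.mk ℂ _ hv)).pt ∈
      {x : (projectiveSpace (n + 1) ℂ).left |
        x ∉ Proj.basicOpen (MvPolynomial.homogeneousSubmodule (Fin (n + 1 + 1)) ℂ)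
          (MvPolynomial.X (Fin.last (n + 1)))} :=
    hZ ▸ Set.mem_univ _
  exact this hmem

/-- **`Hᵏ(ℙⁿ⁺¹_ℂ(ℂ); R) = N¹ Hᵏ` for `k ≥ 1`**: every positive-degree class on projective space has
coniveau `≥ 1`. [cite: BlochOgus1974ENS, (3.8)] [cite: SerreGAGA1956, §2 n°5] -/
theorem ComplexPoints.projectiveSpace_mem_coniveauFiltration_one {k : ℕ} (hk : k ≠ 0)
    (w : singularCohomology R R (ComplexPoints (projectiveSpace (n + 1) ℂ)) k) :
    w ∈ coniveauFiltration R (projectiveSpace (n + 1) ℂ) k 1 := by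
  haveI := IsSmoothProjective.isIntegral_holds (isSmoothProjective_projectiveSpace_holds ℂ (n + 1))
  obtain ⟨Z, hZ, hZne, h0⟩ := ComplexPoints.projectiveSpace_exists_restrictToCompl_eq_zero R n hk w
  exact mem_coniveauFiltration_of_restrictToCompl_eq_zero R k hZ
    (fun z hz ↦ by exact_mod_cast (forall_one_le_coheight_iff_ne_univ hZ).2 hZne z hz) h0

end Literature.AlgebraicGeometry.Motives

end
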